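import Literature.Geometry.Symplectic.TaubesFamilyBochnerIntegral
import Literature.Geometry.Symplectic.TaubesFamilyLTwoBounds
import Literature.Geometry.GaugeTheory.SpincStructureGradNormSq
import HarnessLib

/-!
# Taubes 1994, Lemma 3: the uniform `L²` bound on `∇_A ψ` for the family `(SW_r)`

Topic `Literature/Geometry/Symplectic`; completes the formalisation of Lemma 3 of Taubes 1994
(`TaubesFamilyPointwiseBound`: the `L^∞` bound `|ψ|² ≤ r + z`; this file: the `L²` bound on the
covariant derivative).  Taubes, proof of Lemma 3: "integrating both sides of this last equation over
`X` to obtain the bound on the `L²` norm of `|∇_Aψ|²`": by the Bochner–Kato identity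
`|∇_Aψ|² = Re⟨∇_A^*∇_Aψ, ψ⟩ + ½Σ_k Hess(|ψ|²)(e_k,e_k)` (`TaubesFamilyBochnerIntegral`), the equations
`Re⟨∇_A^*∇_Aψ, ψ⟩ = -(κ/4)|ψ|² - |ψ|⁴/4 + (r/4)(|ψ₁|² - |ψ₀|²) - Re⟨½iρ⁺(η₀)ψ, ψ⟩ ≤ (κ⁻/4 + |η₀⁺| + r/4)|ψ|²`
(`TaubesFamilyWeitzenbock`), the `L^∞` bound, and `∫ Σ_k Hess(|ψ|²)(e_k,e_k) (s ∧ s) = 0`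
(`SymplecticTraceHessianIntegral`), for every solution `(A, ψ)` of `(SW)` with perturbation
`P₊F_{A₀} - (r/4)s` (`r = |c|²`):

  `∫_N |∇_Aψ|² (s ∧ s) ≤ z (1 + r)(r + z) ∫_N s ∧ s`

with `z` depending only on `(N, s, J)` (`exists_integral_gradNormSq_le`).  The regularity inputs —
`|∇_Aψ|²` and `Σ_k Hess(|ψ|²)(e_k,e_k)` are smooth global functions — are
`GaugeTheory/SpincStructureGradNormSq`, `GaugeTheory/SpincStructureTraceHessian`.

PROVED, 0 named facts.

## References

* C. H. Taubes, *The Seiberg–Witten invariants and symplectic forms*, Math. Res. Lett. 1 (1994)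
  809–822, §2 Lemma 3 and its proof (p. 814). [Taubes1994]
* C. H. Taubes, *The Seiberg–Witten and Gromov invariants*, Math. Res. Lett. 2 (1995) 221–238,
  §5 Step 3. [Taubes1995]
-/

noncomputable section

open scoped Manifold ContDiff ComplexConjugate Matrix Topology
open Set Function Filter Complex Literature.Geometry.Kaehler Literature.Geometry.GaugeTheory Literature.Topology.FourManifolds
open Literature.Geometry.Lorentzian (PseudoRiemannianMetric)
open Literature.Geometry.Manifold Literature.Geometry.Manifold.DeRhamSignFour Literature.NumberTheory.Transcendental

namespace Literature.Geometry.Symplectic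

namespace AlmostComplexStructure.IsCompatibleWith

variable {N : Type} [TopologicalSpace N] [ChartedSpace (EuclideanSpace ℝ (Fin 4)) N] [IsManifold (𝓡 4) ∞ N]
  {J : AlmostComplexStructure (𝓡 4) ∞ N} {s : MForm (𝓡 4) N ℝ 2}
  (h : J.IsCompatibleWith s) (hs : IsSmoothForm s)
  (hnd : ∀ x (v : TangentSpace (𝓡 4) x), v ≠ 0 → ∃ w : TangentSpace (𝓡 4) x, s x ![v, w] ≠ 0)
  [(h.metric hs).HasLeviCivita]

/-! ### Regularity of the integrands -/

/-- `|∇_Aψ|²` of the family file is the chart quantity `gradNormSqChart` of `GaugeTheory` read at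
`indexAt x`. [folklore] -/
theorem gradNormSq_eq_gradNormSqChart (cfg : (h.canonicalSpincStructure hs hnd).Configuration) (x : N) :
    h.gradNormSq hs hnd cfg x =
      (h.canonicalSpincStructure hs hnd).gradNormSqChart cfg.conn cfg.spinor ((h.canonicalSpincStructure hs hnd).indexAt x) x := by
  unfold gradNormSq SpincStructure.gradNormSqChart
  refine Finset.sum_congr rfl fun k _ ↦ ?_
  rw [← (h.canonicalSpincStructure hs hnd).covDeriv_eq_localCovDeriv, star_dotProduct_self_eq_spinorHermNormSq,
    Complex.ofReal_re]

/-- **`|∇_Aψ|²` is a smooth function on `N`.** [cite: MorganSWBook1996, §5.2] -/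
theorem contMDiff_gradNormSq (cfg : (h.canonicalSpincStructure hs hnd).Configuration) :
    ContMDiff (𝓡 4) 𝓘(ℝ, ℝ) ∞ (h.gradNormSq hs hnd cfg) := by
  have heq : h.gradNormSq hs hnd cfg = fun x ↦
      (h.canonicalSpincStructure hs hnd).gradNormSqChart cfg.conn cfg.spinor ((h.canonicalSpincStructure hs hnd).indexAt x) x :=
    funext (h.gradNormSq_eq_gradNormSqChart hs hnd cfg)
  rw [heq]
  exact (h.canonicalSpincStructure hs hnd).contMDiff_gradNormSqChart_indexAt cfg.conn cfg.isSmooth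

/-- `|∇_Aψ|² ≥ 0`. [folklore] -/
theorem gradNormSq_nonneg (cfg : (h.canonicalSpincStructure hs hnd).Configuration) (x : N) : 0 ≤ h.gradNormSq hs hnd cfg x := by
  rw [h.gradNormSq_eq_gradNormSqChart hs hnd cfg x]
  exact (h.canonicalSpincStructure hs hnd).gradNormSqChart_nonneg _ _ _ _

/-- **`Σ_k Hess f(e_k, e_k)` is a smooth function on `N`** for smooth `f`. [cite: WarnerGTM94, 6.1] -/
theorem contMDiff_traceHessian {f : N → ℝ} (hf : ContMDiff (𝓡 4) 𝓘(ℝ, ℝ) ∞ f) :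
    ContMDiff (𝓡 4) 𝓘(ℝ, ℝ) ∞ (h.traceHessian hs hnd f) :=
  (h.canonicalSpincStructure hs hnd).contMDiff_sum_hessianAux_frame_indexAt hf

/-! ### The pointwise inequality -/

/-- **The pointwise bound behind Lemma 3**: for a solution `(A, ψ)` of `(SW)` with perturbation
`η₀ - (r/4)s` on the compact manifold,
`|∇_Aψ|²(x) ≤ (K/4 + P + r/4)|ψ(x)|² + ½ Σ_k Hess(|ψ|²)(e_k, e_k)(x)`,
`K = sup κ⁻`, `P = sup |η₀⁺|` (Bochner–Kato, the Weitzenböck identity for solutions, `-|ψ|⁴/4 ≤ 0`,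
`|ψ₁|² - |ψ₀|² ≤ |ψ|²`, `|Re⟨½iρ⁺(η₀)ψ, ψ⟩| ≤ ½|η₀⁺||ψ|²`). [cite: Taubes1994, §2 proof of Lemma 3 (p. 814)] -/
theorem gradNormSq_le_of_isSolution [CompactSpace N] (η₀ : (h.canonicalSpincStructure hs hnd).Perturbation) (c : ℂ)
    {cfg : (h.canonicalSpincStructure hs hnd).Configuration}
    (hsol : SpincStructure.IsSolution (η₀ - h.symplecticPerturbation hs hnd (Complex.normSq c / 4)) cfg) (x : N) :
    h.gradNormSq hs hnd cfg x ≤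
      ((⨆ y, max (-(h.metric hs).scalarCurvature y) 0) / 4 +
          (⨆ y, (h.canonicalSpincStructure hs hnd).perturbationNorm η₀ ((h.canonicalSpincStructure hs hnd).indexAt y) y) +
          Complex.normSq c / 4) * cfg.spinor.hermNormSq x +
        h.traceHessian hs hnd cfg.spinor.hermNormSq x / 2 := by
  have hi := (h.canonicalSpincStructure hs hnd).mem_baseSet_indexAt x
  have hBK := h.traceHessian_hermNormSq_eq hs hnd cfg x
  have hL : h.reLaplacian hs hnd cfg x = _ :=
    h.re_star_dotProduct_localLaplacian_taubes hs hnd η₀ c hsol ((h.canonicalSpincStructure hs hnd).indexAt x) hi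
  -- the ingredients of the bound
  have hn : spinorNormSq (cfg.plusSpinor ((h.canonicalSpincStructure hs hnd).indexAt x) x) = cfg.spinor.hermNormSq x :=
    (SpinorField.hermNormSq_eq_spinorNormSq_plusSpinor cfg hi).symm
  have hn0 : 0 ≤ cfg.spinor.hermNormSq x := by rw [← hn]; exact spinorNormSq_nonneg _
  have hκ : (h.canonicalSpincStructure hs hnd).frameScalarCurv ((h.canonicalSpincStructure hs hnd).indexAt x) x =
      (h.metric hs).scalarCurvature x :=
    (h.canonicalSpincStructure hs hnd).frameScalarCurv_eq_scalarCurvature _ hi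
  have hK : -(h.metric hs).scalarCurvature x ≤ ⨆ y, max (-(h.metric hs).scalarCurvature y) 0 :=
    (le_max_left _ _).trans (le_ciSup (bddAbove_range_scalarCurvatureNeg (h.metric hs)) x)
  have hP : (h.canonicalSpincStructure hs hnd).perturbationNorm η₀ ((h.canonicalSpincStructure hs hnd).indexAt x) x ≤
      ⨆ y, (h.canonicalSpincStructure hs hnd).perturbationNorm η₀ ((h.canonicalSpincStructure hs hnd).indexAt y) y :=
    le_ciSup ((h.canonicalSpincStructure hs hnd).bddAbove_range_perturbationNorm η₀) x
  have hP0 := (h.canonicalSpincStructure hs hnd).perturbationNorm_nonneg η₀ ((h.canonicalSpincStructure hs hnd).indexAt x) x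
  have hE := abs_re_star_dotProduct_half_I_plusAction_le
    (twoFormMatrix η₀.form x fun k ↦ (h.canonicalSpincStructure hs hnd).frame ((h.canonicalSpincStructure hs hnd).indexAt x) k x)
    (cfg.plusSpinor ((h.canonicalSpincStructure hs hnd).indexAt x) x)
  rw [abs_le] at hE
  have hpn : Real.sqrt (∑ k : Fin 3, sdCoeff (twoFormMatrix η₀.form x fun k ↦
      (h.canonicalSpincStructure hs hnd).frame ((h.canonicalSpincStructure hs hnd).indexAt x) k x) k ^ 2) =
      (h.canonicalSpincStructure hs hnd).perturbationNorm η₀ ((h.canonicalSpincStructure hs hnd).indexAt x) x := rfl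
  rw [hpn, hn] at hE
  have h10 : Complex.normSq (cfg.plusSpinor ((h.canonicalSpincStructure hs hnd).indexAt x) x 1) -
      Complex.normSq (cfg.plusSpinor ((h.canonicalSpincStructure hs hnd).indexAt x) x 0) ≤ cfg.spinor.hermNormSq x := by
    rw [← hn, spinorNormSq]
    linarith [Complex.normSq_nonneg (cfg.plusSpinor ((h.canonicalSpincStructure hs hnd).indexAt x) x 0)]
  rw [hn, hκ] at hL
  -- products of non-negative quantities
  have hprodK : -(h.metric hs).scalarCurvature x * cfg.spinor.hermNormSq x ≤
      (⨆ y, max (-(h.metric hs).scalarCurvature y) 0) * cfg.spinor.hermNormSq x :=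
    mul_le_mul_of_nonneg_right hK hn0
  have hprodP : (h.canonicalSpincStructure hs hnd).perturbationNorm η₀ ((h.canonicalSpincStructure hs hnd).indexAt x) x *
      cfg.spinor.hermNormSq x ≤
      (⨆ y, (h.canonicalSpincStructure hs hnd).perturbationNorm η₀ ((h.canonicalSpincStructure hs hnd).indexAt y) y) *
        cfg.spinor.hermNormSq x :=
    mul_le_mul_of_nonneg_right hP hn0
  have hprodr : Complex.normSq c / 4 * (Complex.normSq (cfg.plusSpinor ((h.canonicalSpincStructure hs hnd).indexAt x) x 1) -
      Complex.normSq (cfg.plusSpinor ((h.canonicalSpincStructure hs hnd).indexAt x) x 0)) ≤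
      Complex.normSq c / 4 * cfg.spinor.hermNormSq x :=
    mul_le_mul_of_nonneg_left h10 (by linarith [Complex.normSq_nonneg c])
  nlinarith [hBK, hL, hE.1, hprodK, hprodP, hprodr, sq_nonneg (cfg.spinor.hermNormSq x), hP0, hn0,
    mul_nonneg hP0 hn0]

/-! ### Lemma 3: the `L²` bound -/

/-- **Taubes 1994, Lemma 3 (the `L²` bound on `∇_Aψ`)** for the family `(SW_r)` of `(N, s, J)`: there is
`z ≥ 0`, depending only on `(N, s, J)`, such that every solution `(A, ψ)` of the Seiberg–Witten
equations of `𝔰_J` with perturbation `P₊F_{A₀} - (r/4)s`, `r = |c|² ≥ 0`, satisfies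
`∫_N |∇_Aψ|² (s ∧ s) ≤ z(1 + r)(r + z) ∫_N s ∧ s` — "and the `L²` norm of `∇_Aψ` ... enjoy[s] [an]
`r`-dependent bound[]". Proof as printed: integrate the pointwise inequality
`gradNormSq_le_of_isSolution` (the Laplacian of `|ψ|²` integrating to zero) and insert `|ψ|² ≤ r + z`
(`exists_forall_hermNormSq_le_taubes`). [cite: Taubes1994, §2 Lemma 3 (p. 814)] -/
theorem exists_integral_gradNormSq_le [T2Space N] [CompactSpace N] (hcl : IsClosedForm s) :
    ∃ z : ℝ, 0 ≤ z ∧ ∀ (c : ℂ) (cfg : (h.canonicalSpincStructure hs hnd).Configuration),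
      SpincStructure.IsSolution (h.taubesPerturbation hs hnd - h.symplecticPerturbation hs hnd (Complex.normSq c / 4)) cfg →
        MForm.integral (rayFamily (wedge_self_castDeg_apply_ne_zero s hnd))
            (h.gradNormSq hs hnd cfg • (s.wedge s).castDeg two_add_two_eq_four) ≤
          z * (1 + Complex.normSq c) * (Complex.normSq c + z) *
            MForm.integral (rayFamily (wedge_self_castDeg_apply_ne_zero s hnd)) ((s.wedge s).castDeg two_add_two_eq_four) := by
  obtain ⟨z₀, hz₀, hz⟩ := h.exists_forall_hermNormSq_le_taubes hs hnd
  set K : ℝ := ⨆ y, max (-(h.metric hs).scalarCurvature y) 0 with hKdef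
  set P : ℝ := ⨆ y, (h.canonicalSpincStructure hs hnd).perturbationNorm (h.taubesPerturbation hs hnd)
    ((h.canonicalSpincStructure hs hnd).indexAt y) y with hPdef
  have hv : IsSmoothForm ((s.wedge s).castDeg two_add_two_eq_four) := (wedge_self_castDeg_mem_closedSmoothForms ⟨hs, hcl⟩).1
  have hne := wedge_self_castDeg_apply_ne_zero s hnd
  refine ⟨max z₀ (max (K / 4 + P) 4⁻¹), hz₀.trans (le_max_left _ _), fun c cfg hsol ↦ ?_⟩
  set z : ℝ := max z₀ (max (K / 4 + P) 4⁻¹) with hzdef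
  by_cases hN : Nonempty N
  swap
  · -- empty manifold: both integrals vanish
    haveI : IsEmpty N := not_nonempty_iff.1 hN
    have h0 : ∀ α : MForm (𝓡 4) N ℝ 4, MForm.integral (rayFamily hne) α = 0 := fun α ↦ by
      change ∑ᶠ i : N, _ = (0 : ℝ)
      exact finsum_of_isEmpty _
    rw [h0, h0, mul_zero]
  haveI : Nonempty N := hN
  have hV0 : 0 ≤ MForm.integral (rayFamily hne) ((s.wedge s).castDeg two_add_two_eq_four) :=
    (integral_self_pos hv hne).le
  obtain ⟨x₀⟩ := hN
  have hK0 : 0 ≤ K := (le_max_right _ _).trans (le_ciSup (bddAbove_range_scalarCurvatureNeg (h.metric hs)) x₀)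
  have hP0 : 0 ≤ P := ((h.canonicalSpincStructure hs hnd).perturbationNorm_nonneg _ _ x₀).trans
    (le_ciSup ((h.canonicalSpincStructure hs hnd).bddAbove_range_perturbationNorm (h.taubesPerturbation hs hnd)) x₀)
  -- the pointwise inequality with the `L^∞` bound inserted
  set C : ℝ := K / 4 + P + Complex.normSq c / 4 with hCdef
  have hC0 : 0 ≤ C := by
    have := Complex.normSq_nonneg c
    positivity
  have hpt : ∀ x, h.gradNormSq hs hnd cfg x ≤
      2⁻¹ * h.traceHessian hs hnd cfg.spinor.hermNormSq x + C * (Complex.normSq c + z₀) := fun x ↦ by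
    have h1 := h.gradNormSq_le_of_isSolution hs hnd (h.taubesPerturbation hs hnd) c hsol x
    have h2 : C * cfg.spinor.hermNormSq x ≤ C * (Complex.normSq c + z₀) := mul_le_mul_of_nonneg_left (hz c cfg hsol x) hC0
    rw [← hCdef] at h1
    linarith
  have hf := h.contMDiff_gradNormSq hs hnd cfg
  have htr := h.contMDiff_traceHessian hs hnd ((h.canonicalSpincStructure hs hnd).contMDiff_hermNormSq cfg.isSmooth)
  have hg : ContMDiff (𝓡 4) 𝓘(ℝ, ℝ) ∞ fun x ↦ 2⁻¹ * h.traceHessian hs hnd cfg.spinor.hermNormSq x + C * (Complex.normSq c + z₀) :=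
    (contMDiff_const.mul htr).add contMDiff_const
  have hmono := integral_fun_smul_mono hv hne hf hg hpt
  rw [integral_const_mul_add_const_smul hv hne htr, h.integral_traceHessian_smul_wedge_self_eq_zero hs hnd hcl
    ((h.canonicalSpincStructure hs hnd).contMDiff_hermNormSq cfg.isSmooth), mul_zero, zero_add] at hmono
  -- `C (r + z₀) ≤ z (1 + r)(r + z)`
  have hr := Complex.normSq_nonneg c
  have hz1 : K / 4 + P ≤ z := (le_max_left _ _).trans (le_max_right _ _)
  have hz2 : (4⁻¹ : ℝ) ≤ z := (le_max_right _ _).trans (le_max_right _ _)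
  have hz3 : z₀ ≤ z := le_max_left _ _
  have hzz : 0 ≤ z := hz₀.trans hz3
  have hCle : C ≤ z * (1 + Complex.normSq c) := by
    rw [hCdef]
    nlinarith
  have hfin : C * (Complex.normSq c + z₀) ≤ z * (1 + Complex.normSq c) * (Complex.normSq c + z) :=
    mul_le_mul hCle (by linarith) (by linarith) (by positivity)
  exact hmono.trans (mul_le_mul_of_nonneg_right hfin hV0)

end AlmostComplexStructure.IsCompatibleWith

end Literature.Geometry.Symplectic

end
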